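import Mathlib
import HarnessLib
import Summits.Ventures.LatticeQCDFlow.TrivializingMaps.GradedTheoremA
import Summits.Ventures.LatticeQCDFlow.TrivializingMaps.UniformRadiusAllBeta
import Summits.Ventures.LatticeQCDFlow.TrivializingMaps.LogDepthWilsonFlowSampler
import Summits.Ventures.LatticeQCDFlow.TrivializingMaps.LocalModeNormEquivalence

/-!
HONEST FRAMING: exact (Metropolis-corrected) sampling algorithms for lattice gauge theory; figures of
merit are autocorrelation/cost numbers at stated couplings and volumes; no continuum-physics claim.
THEOREM A is a statement about Lüscher's formal power series on finite periodic lattices (a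
volume-uniform radius of the link-gradient series), not a continuum claim.

# THEOREM A — the unconditional corollaries (FANOUT-theory1 §13 R-T1-59; cell pub-lqcd, rows 28/30)

`GradedTheoremA.lean` (theory-1 GEN-10, row 58) proves the venture's open `@[conjecture]` node
`LuscherGeometricGradientBound d n` (`Truncation.lean` §6): for every `d` and `n` there are `ρ > 0` and `C`
such that for EVERY lattice size `L`, every orthonormal basis `B` of `𝔰𝔲(n)` and every smooth solution
`(S̃^{(k)})_k` of Lüscher's recursion for the Wilson plaquette action, `|∂^a_e S̃^{(k)}(ιU)| ≤ C ρ^{-k}`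
(`GradedSeries.luscherGeometricGradientBound_holds`).  The tree already holds the consequences of that node
as theorems CONDITIONAL on it (`…_of_geometric`, `…_of_hasLocalModeNorm`); this file discharges the
hypothesis, so each is now an unconditional theorem (one-line applications; nothing else is claimed):

* `luscherUniformRadius_holds d n β : LuscherUniformRadius d n β` — conjecture item C1 of the venture
  (`UniformRadius.lean`, `@[conjecture]`): Lüscher's trivializing-flow gradient series for `β·S_W` has a
  convergence radius in `t` that does not depend on the lattice size, at EVERY coupling `β`
  (via `luscherUniformRadius_of_geometric`, row 37);
* `hasLocalModeNorm_holds d n B₀ : HasLocalModeNorm d n B₀` — the local-mode-norm obligation of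
  `LocalModeNorm.lean` (`@[conjecture]`), via `hasLocalModeNorm_iff_luscherGeometricGradientBound` (row 38);
* `truncatedWilsonFlowSampler_geometric d n` — the exact order-`N` Wilson-flow sampler with defect constant
  `D ρ^{-N}`: exactness, weight window, acceptance floor `e^{-M}` from every configuration, Doeblin, mixing
  (the conclusion of `truncatedWilsonFlowSampler_of_geometric`, row 31, verbatim);
* `logDepthWilsonFlowSampler d n` — the LOG-DEPTH LAW: in the geometric regime `|β| ≤ (1-η)ρ`, truncation
  order `N ≥ log(D ρ² |E| / ε) / (-log(1-η))` — logarithmic in the number of links — gives an `ε`-exact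
  sampler with acceptance `≥ e^{-ε}` everywhere (conclusion of `logDepthWilsonFlowSampler_of_geometric`,
  row 31, verbatim).

References: M. Lüscher, Commun. Math. Phys. 293 (2010) 899–919 [arXiv:0907.5491], §4.3–§4.5, §6;
THEORY-1.md §12, §16–§19.  Tags: [ours] = venture work.
-/

noncomputable section

namespace Summit.Ventures.LatticeQCDFlow.TrivializingMaps

open MeasureTheory ProbabilityTheory
open Literature.MathematicalPhysics.QuantumFieldTheory
open Literature.MathematicalPhysics.QuantumFieldTheory.Luscher2010
open Summit.Ventures.LatticeQCDFlow.Exactness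
open scoped ENNReal Matrix Matrix.Norms.Frobenius ContDiff

/-- **C1 — Lüscher's volume-uniform radius at every coupling (ours; PROVED, unconditional).**  For every
`d`, `n` and `β` there is `r > 0` such that for every lattice size `L`, every orthonormal basis of `𝔰𝔲(n)`
and every smooth solution of Lüscher's recursion for `β·S_W`, the link-gradient series
`∑_k |t|^k |∂^a_e S̃^{(k)}(ιU)|` converges for `|t| < r` (`LuscherUniformRadius d n β`, the venture's
conjecture item C1; radius `ρ/|β|` from Theorem A). [ours] -/
theorem luscherUniformRadius_holds (d n : ℕ) (β : ℝ) : LuscherUniformRadius d n β :=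
  luscherUniformRadius_of_geometric (GradedSeries.luscherGeometricGradientBound_holds d n) β

/-- **The local-mode-norm obligation holds (ours; PROVED, unconditional).**  For every orthonormal basis
`B₀` of `𝔰𝔲(n)` there are `θ`, `N₀` and, at every lattice size, `LocalModeNormData d n B₀ θ N₀ L`
(`HasLocalModeNorm d n B₀`, the `@[conjecture]` node of `LocalModeNorm.lean`), by its equivalence with
Theorem A (`hasLocalModeNorm_iff_luscherGeometricGradientBound`). [ours] -/
theorem hasLocalModeNorm_holds (d n : ℕ) (B₀ : SuBasis n) : HasLocalModeNorm d n B₀ :=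
  (hasLocalModeNorm_iff_luscherGeometricGradientBound d n B₀).2
    (GradedSeries.luscherGeometricGradientBound_holds d n)

/-- **The exact order-`N` Wilson-flow sampler with geometric defect constant (ours; PROVED,
unconditional).**  There are `ρ > 0` and `D = D(d,n) ≥ 0` such that for every truncation order `N`,
coupling `β`, volume `L`, basis, smooth solution of the recursion for `β S_W`, flow `Φ` of `-∂S̃^{[N]}_t`
with output law `q`, and every `M ≥ 2|β|^{N+2} D ρ^{-N} |E|/(N+2)`: a measurable weight `w ∈ [e^{-M}, e^M]`
with `w·q = π_β` exactly, `π_β` invariant under the independence Metropolis kernel, acceptance `≥ e^{-M}`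
from EVERY configuration, Doeblin minorisation `e^{-M} π_β ≤ K(U, ·)`, and `|μKᵗ(A) - π_β(A)| ≤ (1-e^{-M})ᵗ`
(the conclusion of `truncatedWilsonFlowSampler_of_geometric`, now with Theorem A discharged). [ours] -/
theorem truncatedWilsonFlowSampler_geometric (d n : ℕ) :
    ∃ ρ : ℝ, 0 < ρ ∧ ∃ D : ℝ, 0 ≤ D ∧
    ∀ (N : ℕ) (β : ℝ) (L : ℕ) [NeZero L] (B : SuBasis n) (Sk : ℕ → AmbConfig d L n → ℝ)
      (c : ℕ → ℝ), (∀ k, ContDiff ℝ ∞ (Sk k)) → IsLuscherSeries B (fun W => β * ambWilsonAction W) Sk c →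
      ∀ (Φ : ℝ → GaugeConfig d L (Matrix.specialUnitaryGroup (Fin n) ℂ) →
          GaugeConfig d L (Matrix.specialUnitaryGroup (Fin n) ℂ)),
        IsFlowMap (fun t W => -linkGrad B (truncFlowAction Sk t N) W) Φ →
      ∀ (q : Measure (GaugeConfig d L (Matrix.specialUnitaryGroup (Fin n) ℂ))) [IsProbabilityMeasure q],
        q = Measure.map (Φ 1) (trivialMeasure (Matrix.specialUnitaryGroup (Fin n) ℂ) d L) →
      ∀ M : ℝ, 2 * (|β| ^ (N + 2) * (D * ρ⁻¹ ^ N) * Fintype.card (Edge d L)) / (N + 2) ≤ M →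
      ∃ w : GaugeConfig d L (Matrix.specialUnitaryGroup (Fin n) ℂ) → ℝ, Measurable w ∧
        (∀ U, Real.exp (-M) ≤ w U) ∧ (∀ U, w U ≤ Real.exp M) ∧
        (q.withDensity fun U => ENNReal.ofReal (w U)) =
          boltzmannMeasure (fun U : GaugeConfig d L (Matrix.specialUnitaryGroup (Fin n) ℂ) =>
            β * ambWilsonAction (WilsonFlow.coeConfig U)) ∧
        Kernel.Invariant (indepMH q w)
          (boltzmannMeasure fun U : GaugeConfig d L (Matrix.specialUnitaryGroup (Fin n) ℂ) =>
            β * ambWilsonAction (WilsonFlow.coeConfig U)) ∧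
        (∀ U, ENNReal.ofReal (Real.exp (-M)) ≤ imhAcceptMass q w U) ∧
        (∀ (U : GaugeConfig d L (Matrix.specialUnitaryGroup (Fin n) ℂ))
          (A : Set (GaugeConfig d L (Matrix.specialUnitaryGroup (Fin n) ℂ))), MeasurableSet A →
          ENNReal.ofReal (Real.exp (-M)) *
              boltzmannMeasure (fun U : GaugeConfig d L (Matrix.specialUnitaryGroup (Fin n) ℂ) =>
                β * ambWilsonAction (WilsonFlow.coeConfig U)) A ≤ indepMH q w U A) ∧
        ∀ (μ : Measure (GaugeConfig d L (Matrix.specialUnitaryGroup (Fin n) ℂ))) [IsProbabilityMeasure μ]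
          (t : ℕ) (A : Set (GaugeConfig d L (Matrix.specialUnitaryGroup (Fin n) ℂ))),
          |((fun m : Measure (GaugeConfig d L (Matrix.specialUnitaryGroup (Fin n) ℂ)) =>
                m.bind (indepMH q w))^[t] μ).real A -
              (boltzmannMeasure fun U : GaugeConfig d L (Matrix.specialUnitaryGroup (Fin n) ℂ) =>
                β * ambWilsonAction (WilsonFlow.coeConfig U)).real A| ≤ (1 - Real.exp (-M)) ^ t :=
  truncatedWilsonFlowSampler_of_geometric (GradedSeries.luscherGeometricGradientBound_holds d n)

/-- **The LOG-DEPTH LAW for the exact Wilson-flow sampler (ours; PROVED, unconditional).**  There are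
`ρ > 0` and `D ≥ 0` such that for every `0 < η < 1`, `ε > 0`, coupling `|β| ≤ (1-η)ρ`, periodic volume
`L^d` and truncation order `N ≥ log(D ρ² |E| / ε) / (-log(1-η))` — LOGARITHMIC in the number of links
`|E| = d·L^d` — the exact order-`N` Wilson-flow sampler (any smooth solution of the recursion for `β S_W`,
any flow of `-∂S̃^{[N]}_t`, output law `q`) has a weight `e^{-ε} ≤ w ≤ e^{ε}` with `w·q = π_β`, is exact,
accepts from every configuration with probability `≥ e^{-ε}`, satisfies Doeblin `K(U,·) ≥ e^{-ε} π_β` and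
`|μKᵗ(A) - π_β(A)| ≤ (1-e^{-ε})ᵗ` (the conclusion of `logDepthWilsonFlowSampler_of_geometric`, now with
Theorem A discharged). [ours] -/
theorem logDepthWilsonFlowSampler (d n : ℕ) :
    ∃ ρ : ℝ, 0 < ρ ∧ ∃ D : ℝ, 0 ≤ D ∧
    ∀ (η ε : ℝ), 0 < η → η < 1 → 0 < ε → ∀ (β : ℝ), |β| ≤ (1 - η) * ρ →
    ∀ (L : ℕ) [NeZero L] (N : ℕ),
      Real.log (D * ρ ^ 2 * Fintype.card (Edge d L) / ε) / -Real.log (1 - η) ≤ N →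
    ∀ (B : SuBasis n) (Sk : ℕ → AmbConfig d L n → ℝ) (c : ℕ → ℝ),
      (∀ k, ContDiff ℝ ∞ (Sk k)) → IsLuscherSeries B (fun W => β * ambWilsonAction W) Sk c →
      ∀ (Φ : ℝ → GaugeConfig d L (Matrix.specialUnitaryGroup (Fin n) ℂ) →
          GaugeConfig d L (Matrix.specialUnitaryGroup (Fin n) ℂ)),
        IsFlowMap (fun t W => -linkGrad B (truncFlowAction Sk t N) W) Φ →
      ∀ (q : Measure (GaugeConfig d L (Matrix.specialUnitaryGroup (Fin n) ℂ))) [IsProbabilityMeasure q],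
        q = Measure.map (Φ 1) (trivialMeasure (Matrix.specialUnitaryGroup (Fin n) ℂ) d L) →
      ∃ w : GaugeConfig d L (Matrix.specialUnitaryGroup (Fin n) ℂ) → ℝ, Measurable w ∧
        (∀ U, Real.exp (-ε) ≤ w U) ∧ (∀ U, w U ≤ Real.exp ε) ∧
        (q.withDensity fun U => ENNReal.ofReal (w U)) =
          boltzmannMeasure (fun U : GaugeConfig d L (Matrix.specialUnitaryGroup (Fin n) ℂ) =>
            β * ambWilsonAction (WilsonFlow.coeConfig U)) ∧
        Kernel.Invariant (indepMH q w)
          (boltzmannMeasure fun U : GaugeConfig d L (Matrix.specialUnitaryGroup (Fin n) ℂ) =>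
            β * ambWilsonAction (WilsonFlow.coeConfig U)) ∧
        (∀ U, ENNReal.ofReal (Real.exp (-ε)) ≤ imhAcceptMass q w U) ∧
        (∀ (U : GaugeConfig d L (Matrix.specialUnitaryGroup (Fin n) ℂ))
          (A : Set (GaugeConfig d L (Matrix.specialUnitaryGroup (Fin n) ℂ))), MeasurableSet A →
          ENNReal.ofReal (Real.exp (-ε)) *
              boltzmannMeasure (fun U : GaugeConfig d L (Matrix.specialUnitaryGroup (Fin n) ℂ) =>
                β * ambWilsonAction (WilsonFlow.coeConfig U)) A ≤ indepMH q w U A) ∧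
        ∀ (μ : Measure (GaugeConfig d L (Matrix.specialUnitaryGroup (Fin n) ℂ))) [IsProbabilityMeasure μ]
          (t : ℕ) (A : Set (GaugeConfig d L (Matrix.specialUnitaryGroup (Fin n) ℂ))),
          |((fun m : Measure (GaugeConfig d L (Matrix.specialUnitaryGroup (Fin n) ℂ)) =>
                m.bind (indepMH q w))^[t] μ).real A -
              (boltzmannMeasure fun U : GaugeConfig d L (Matrix.specialUnitaryGroup (Fin n) ℂ) =>
                β * ambWilsonAction (WilsonFlow.coeConfig U)).real A| ≤ (1 - Real.exp (-ε)) ^ t :=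
  logDepthWilsonFlowSampler_of_geometric (GradedSeries.luscherGeometricGradientBound_holds d n)

end Summit.Ventures.LatticeQCDFlow.TrivializingMaps

end
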